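import Summits.Ventures.PercRepro.RankDistEarsBottom
import Summits.Ventures.PercRepro.RankDistBookPattern

/-!
# PercRepro — `C₄ + ears`: THE SHADOW LEVELS ARE THE LEVEL SUM (p9, gen 24)

THE THEOREM (`card_shadowLev_ears`): on the tight layer `(K + 3, K + 1)` of `C₄ + ears` (`K = Σ_j k j`),
`s_u = #∂_u 𝓑 = levelSum k u` for every `u` — the number of rank-`u` sets containing a bottom set is the finite sum
`Σ_X Σ_T [levelCond K u X T] · Π_j hostCount (k j) (T j)` over the host edges `X` and the host types `T`
(`RankDistEarsLevelSum`), which the kernel evaluates. Proof: a set is its pattern `(X, g)` (`card_filter_ears`,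
`Finset.card_nbij'`); the up-set and the rank are read off `X` and the host type of `g`
(`exists_mem_Uq_subset_iff_ears`, `rk_ears_pat`); the patterns of a given host type are counted host by host
(`card_fiber_hostType`, through `Equiv.piCurry` and `Fintype.piFinset`), and on one host with `m` ears the four types
have `2^m`, `3^m − 2^m`, `m·2^{m−1}`, `m·(3^{m−1} − 2^{m−1})` patterns (`card_host_type`, from the book's
`card_pg_*` counts). Nothing here moves any window of the crux.
-/

namespace PercRepro.RankDist

open Set Finset _root_.Matroid PercRepro.ThmH

/-! ## One host: the patterns of a given type -/

section OneHost

variable {m : ℕ}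

/-- The number of missed ears of a one-host pattern. -/
def perMiss (h : Fin m → Finset Bool) : ℕ := (Finset.univ.filter (fun x => h x = ∅)).card

/-- Whether a one-host pattern has a full ear. -/
def perFull (h : Fin m → Finset Bool) : Bool := decide (∃ x, h x = Finset.univ)

/-- The type of a one-host pattern. -/
def perType (h : Fin m → Finset Bool) : Bool × Bool := (decide (perMiss h = 1), perFull h)

/-- Patterns with one empty page and every other page a singleton: `m · 2^{m−1}`. -/
lemma card_pg_one_empty_singleton :
    ((Finset.univ : Finset (Fin m → Finset Bool)).filter
      (fun g => (Finset.univ.filter (fun i => g i = ∅)).card = 1 ∧ ∀ i, g i ≠ Finset.univ)).card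
      = m * 2 ^ (m - 1) := by
  classical
  have e : (Finset.univ : Finset (Fin m → Finset Bool)).filter
        (fun g => (Finset.univ.filter (fun i => g i = ∅)).card = 1 ∧ ∀ i, g i ≠ Finset.univ)
      = Finset.univ.biUnion (fun i₀ : Fin m => Fintype.piFinset (fun i : Fin m =>
          if i = i₀ then ({∅} : Finset (Finset Bool))
          else (Finset.univ : Finset (Finset Bool)).filter (fun s => s.card = 1))) := by
    ext g
    simp only [Finset.mem_filter, Finset.mem_univ, true_and, Finset.mem_biUnion, Fintype.mem_piFinset]
    rw [Finset.card_eq_one]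
    constructor
    · rintro ⟨⟨i₀, hi₀⟩, hnu⟩
      have hmem : ∀ i, g i = ∅ ↔ i = i₀ := by
        intro i
        have h' : i ∈ Finset.univ.filter (fun i => g i = ∅) ↔ i ∈ ({i₀} : Finset (Fin m)) := by rw [hi₀]
        rw [Finset.mem_filter, Finset.mem_singleton] at h'
        simpa using h'
      refine ⟨i₀, fun i => ?_⟩
      by_cases h : i = i₀
      · rw [if_pos h, Finset.mem_singleton]
        exact (hmem i).2 h
      · rw [if_neg h, Finset.mem_filter]
        exact ⟨Finset.mem_univ _, (card_eq_one_iff_finset_bool _).2 ⟨fun h' => h ((hmem i).1 h'), hnu i⟩⟩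
    · rintro ⟨i₀, h⟩
      refine ⟨⟨i₀, ?_⟩, ?_⟩
      · ext i
        simp only [Finset.mem_filter, Finset.mem_univ, true_and, Finset.mem_singleton]
        have hi := h i
        by_cases hii : i = i₀
        · rw [if_pos hii, Finset.mem_singleton] at hi
          exact ⟨fun _ => hii, fun _ => hi⟩
        · rw [if_neg hii, Finset.mem_filter] at hi
          exact ⟨fun h' => absurd h' (((card_eq_one_iff_finset_bool _).1 hi.2).1), fun h' => absurd h' hii⟩
      · intro i
        have hi := h i
        by_cases hii : i = i₀
        · rw [if_pos hii, Finset.mem_singleton] at hi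
          rw [hi]; exact Finset.univ_nonempty.ne_empty.symm
        · rw [if_neg hii, Finset.mem_filter] at hi
          exact ((card_eq_one_iff_finset_bool _).1 hi.2).2
  rw [e, Finset.card_biUnion]
  · have hc : ∀ i₀ : Fin m, (Fintype.piFinset (fun i : Fin m =>
        if i = i₀ then ({∅} : Finset (Finset Bool))
        else (Finset.univ : Finset (Finset Bool)).filter (fun s => s.card = 1))).card = 2 ^ (m - 1) := by
      intro i₀
      rw [Fintype.card_piFinset]
      have e2 : ∀ i : Fin m, (if i = i₀ then ({∅} : Finset (Finset Bool))
          else (Finset.univ : Finset (Finset Bool)).filter (fun s => s.card = 1)).card = if i = i₀ then 1 else 2 := by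
        intro i
        split_ifs
        · exact Finset.card_singleton _
        · exact card_singleton_finset_bool
      simp_rw [e2]
      rw [Finset.prod_ite, Finset.prod_const, Finset.prod_const, Finset.filter_eq', if_pos (Finset.mem_univ _),
        Finset.filter_ne', Finset.card_singleton, Finset.card_erase_of_mem (Finset.mem_univ _), Finset.card_univ,
        Fintype.card_fin, one_pow, one_mul]
    simp_rw [hc]
    rw [Finset.sum_const, Finset.card_univ, Fintype.card_fin, smul_eq_mul]
  · intro i₀ _ i₁ _ hne
    rw [Function.onFun, Finset.disjoint_left]
    intro g hg₀ hg₁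
    rw [Fintype.mem_piFinset] at hg₀ hg₁
    have h0 := hg₀ i₀
    have h1 := hg₁ i₀
    rw [if_pos rfl, Finset.mem_singleton] at h0
    rw [if_neg hne, Finset.mem_filter] at h1
    rw [h0] at h1
    simp at h1

/-- **The patterns of one host by type**: `hostCount m t` patterns `Fin m → Finset Bool` have at most one missed
ear and the type `t`. -/
theorem card_host_type (t : Bool × Bool) :
    ((Finset.univ : Finset (Fin m → Finset Bool)).filter (fun h => perMiss h ≤ 1 ∧ perType h = t)).card
      = hostCount m t := by
  classical
  rcases t with ⟨b1, b2⟩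
  rcases b1 with _ | _ <;> rcases b2 with _ | _
  · -- (false, false): no miss, no full ⟺ every page a singleton
    rw [show hostCount m (false, false) = 2 ^ m from rfl, ← card_pg_singleton]
    congr 1
    apply Finset.filter_congr
    intro h _
    simp only [perType, perFull, perMiss, Prod.mk.injEq, decide_eq_false_iff_not, not_exists]
    constructor
    · rintro ⟨hle, hne1, hnu⟩
      have h0 : (Finset.univ.filter (fun x => h x = ∅)).card = 0 := by omega
      rw [Finset.card_eq_zero, Finset.filter_eq_empty_iff] at h0
      intro i
      exact (card_eq_one_iff_finset_bool _).2 ⟨h0 (Finset.mem_univ i), hnu i⟩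
    · intro h1
      have h0 : (Finset.univ.filter (fun x => h x = ∅)).card = 0 := by
        rw [Finset.card_eq_zero, Finset.filter_eq_empty_iff]
        intro i _
        exact ((card_eq_one_iff_finset_bool _).1 (h1 i)).1
      exact ⟨by omega, by omega, fun i => ((card_eq_one_iff_finset_bool _).1 (h1 i)).2⟩
  · -- (false, true): no miss, some full
    rw [show hostCount m (false, true) = 3 ^ m - 2 ^ m from rfl, ← card_pg_nonempty_full]
    congr 1
    apply Finset.filter_congr
    intro h _
    simp only [perType, perFull, perMiss, Prod.mk.injEq, decide_eq_false_iff_not, decide_eq_true_eq]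
    constructor
    · rintro ⟨hle, hne1, hex⟩
      have h0 : (Finset.univ.filter (fun x => h x = ∅)).card = 0 := by omega
      rw [Finset.card_eq_zero, Finset.filter_eq_empty_iff] at h0
      exact ⟨fun i => h0 (Finset.mem_univ i), hex⟩
    · rintro ⟨hne, hex⟩
      have h0 : (Finset.univ.filter (fun x => h x = ∅)).card = 0 := by
        rw [Finset.card_eq_zero, Finset.filter_eq_empty_iff]
        intro i _
        exact hne i
      exact ⟨by omega, by omega, hex⟩
  · -- (true, false): one miss, no full
    rw [show hostCount m (true, false) = m * 2 ^ (m - 1) from rfl, ← card_pg_one_empty_singleton]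
    congr 1
    apply Finset.filter_congr
    intro h _
    simp only [perType, perFull, perMiss, Prod.mk.injEq, decide_eq_true_eq, decide_eq_false_iff_not, not_exists]
    constructor
    · rintro ⟨-, h1, hnu⟩; exact ⟨h1, hnu⟩
    · rintro ⟨h1, hnu⟩; exact ⟨by omega, h1, hnu⟩
  · -- (true, true): one miss, some full = (one miss) − (one miss, no full)
    rw [show hostCount m (true, true) = m * (3 ^ (m - 1) - 2 ^ (m - 1)) from rfl, Nat.mul_sub,
      ← card_pg_one_empty, ← card_pg_one_empty_singleton]
    have hsplit := Finset.card_filter_add_card_filter_not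
      (s := (Finset.univ : Finset (Fin m → Finset Bool)).filter
        (fun g => (Finset.univ.filter (fun i => g i = ∅)).card = 1))
      (p := fun g => ∀ i, g i ≠ Finset.univ)
    rw [Finset.filter_filter, Finset.filter_filter] at hsplit
    have e1 : (Finset.univ : Finset (Fin m → Finset Bool)).filter
        (fun h => perMiss h ≤ 1 ∧ perType h = (true, true))
        = (Finset.univ : Finset (Fin m → Finset Bool)).filter
          (fun g => (Finset.univ.filter (fun i => g i = ∅)).card = 1 ∧ ¬ ∀ i, g i ≠ Finset.univ) := by
      apply Finset.filter_congr
      intro h _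
      simp only [perType, perFull, perMiss, Prod.mk.injEq, decide_eq_true_eq, not_forall, not_not]
      constructor
      · rintro ⟨-, h1, hex⟩; exact ⟨h1, hex⟩
      · rintro ⟨h1, hex⟩; exact ⟨by omega, h1, hex⟩
    rw [e1]
    omega

end OneHost

/-! ## All hosts: the patterns of a given host type -/

variable {k : Fin 4 → ℕ}

/-- The missed ears on the host `j` are the missed ears of the `j`-th component. -/
lemma hostMiss_eq_perMiss (g : Ear k → Finset Bool) (j : Fin 4) :
    hostMiss k g j = perMiss (fun x : Fin (k j) => g ⟨j, x⟩) := by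
  unfold hostMiss perMiss
  have e : Finset.univ.filter (fun i : Ear k => i.1 = j ∧ g i = ∅)
      = (Finset.univ.filter (fun x : Fin (k j) => g ⟨j, x⟩ = ∅)).image (Sigma.mk j) := by
    ext i
    rcases i with ⟨j', x⟩
    simp only [Finset.mem_image, Finset.mem_filter, Finset.mem_univ, true_and]
    constructor
    · rintro ⟨rfl, h⟩
      exact ⟨x, h, rfl⟩
    · rintro ⟨x', hx', hxx⟩
      rw [Sigma.mk.injEq] at hxx
      obtain ⟨rfl, hx⟩ := hxx
      rw [heq_iff_eq] at hx
      subst hx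
      exact ⟨rfl, hx'⟩
  rw [e, Finset.card_image_of_injective _ sigma_mk_injective]

/-- The full ears on the host `j` are the full ears of the `j`-th component. -/
lemma hostFull_eq_perFull (g : Ear k → Finset Bool) (j : Fin 4) :
    hostFull k g j = perFull (fun x : Fin (k j) => g ⟨j, x⟩) := by
  unfold hostFull perFull
  apply decide_eq_decide.2
  constructor
  · rintro ⟨⟨j', x⟩, hj, h⟩
    simp only at hj
    subst hj
    exact ⟨x, h⟩
  · rintro ⟨x, h⟩
    exact ⟨⟨j, x⟩, rfl, h⟩

/-- The host type is the type of the component. -/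
lemma hostType_eq_perType (g : Ear k → Finset Bool) (j : Fin 4) :
    hostType k g j = perType (fun x : Fin (k j) => g ⟨j, x⟩) := by
  unfold hostType perType
  rw [hostMiss_eq_perMiss, hostFull_eq_perFull]

/-- **The patterns of a given host type**, with at most one missed ear per host: `Π_j hostCount (k j) (T j)`. -/
theorem card_fiber_hostType (T : Fin 4 → Bool × Bool) :
    ((Finset.univ : Finset (Ear k → Finset Bool)).filter
      (fun g => (∀ j, hostMiss k g j ≤ 1) ∧ hostType k g = T)).card = ∏ j, hostCount (k j) (T j) := by
  classical
  rw [Finset.card_equiv (Equiv.piCurry (fun (_ : Fin 4) (_ : Fin _) => Finset Bool))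
    (t := Fintype.piFinset (fun j => (Finset.univ : Finset (Fin (k j) → Finset Bool)).filter
      (fun h => perMiss h ≤ 1 ∧ perType h = T j)))]
  · rw [Fintype.card_piFinset]
    exact Finset.prod_congr rfl (fun j _ => card_host_type (T j))
  · intro g
    simp only [Finset.mem_filter, Finset.mem_univ, true_and, Fintype.mem_piFinset, Equiv.piCurry,
      Equiv.coe_fn_mk, funext_iff, hostMiss_eq_perMiss, hostType_eq_perType]
    exact ⟨fun ⟨h1, h2⟩ j => ⟨h1 j, h2 j⟩, fun h => ⟨fun j => (h j).1, fun j => (h j).2⟩⟩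

/-! ## The level sum -/

/-- The patterns satisfying the level condition are counted by `levelSum`. -/
theorem card_filter_pattern_eq_levelSum (u : ℕ) :
    ((Finset.univ : Finset (Finset (Fin 4) × (Ear k → Finset Bool))).filter
      (fun x => (∀ j, hostMiss k x.2 j ≤ 1) ∧ levelCond (∑ j, k j) u x.1 (hostType k x.2) = true)).card
      = levelSum k u := by
  classical
  unfold levelSum
  rw [Finset.card_eq_sum_ones, Finset.sum_filter, Fintype.sum_prod_type]
  refine Finset.sum_congr rfl (fun X _ => ?_)
  rw [← Finset.sum_filter, ← Finset.card_eq_sum_ones,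
    Finset.card_eq_sum_card_fiberwise (f := hostType k) (t := Finset.univ) (fun _ _ => Finset.mem_univ _)]
  refine Finset.sum_congr rfl (fun T _ => ?_)
  rw [Finset.filter_filter]
  split_ifs with hT
  · rw [← card_fiber_hostType T]
    congr 1
    apply Finset.filter_congr
    intro g _
    constructor
    · rintro ⟨⟨h1, -⟩, h2⟩; exact ⟨h1, h2⟩
    · rintro ⟨h1, h2⟩; exact ⟨⟨h1, by rw [h2]; exact hT⟩, h2⟩
  · rw [Finset.card_eq_zero, Finset.filter_eq_empty_iff]
    rintro g - ⟨⟨-, h⟩, h2⟩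
    rw [h2] at h
    exact hT h

/-- The rank and the up-set pattern, as the level condition on the host type. -/
lemma rank_upPat_iff_levelCond (X : Finset (Fin 4)) (g : Ear k → Finset Bool) (u : ℕ) :
    ((Finset.univ.filter (fun i : Ear k => g i ≠ ∅)).card
        + min (X ∪ (Finset.univ.filter (fun i : Ear k => g i = Finset.univ)).image Sigma.fst).card 3 = u
      ∧ UpPat k X g) ↔
    ((∀ j, hostMiss k g j ≤ 1) ∧ levelCond (∑ j, k j) u X (hostType k g) = true) := by
  have hK := card_hit_add_card_miss g
  have hF : (Finset.univ.filter (fun i : Ear k => g i = Finset.univ)).image Sigma.fst = typeF (hostType k g) :=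
    image_fst_fullSet g
  rw [hF]
  unfold UpPat levelCond upCond
  simp only [Bool.and_eq_true, decide_eq_true_eq]
  constructor
  · rintro ⟨hr, hle1, hsub, hcard, hM2⟩
    have hMi := card_missSet_of_le_one g hle1
    refine ⟨hle1, ⟨⟨hsub, hcard⟩, hM2⟩, ?_⟩
    omega
  · rintro ⟨hle1, ⟨⟨hsub, hcard⟩, hM2⟩, hr⟩
    have hMi := card_missSet_of_le_one g hle1
    refine ⟨?_, hle1, hsub, hcard, hM2⟩
    omega

/-- **Counting subsets by their pattern**: the subsets `A ⊆ E` whose pattern satisfies `P` are as many as the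
patterns satisfying `P`. -/
theorem card_filter_ears (P : Finset (Fin 4) → (Ear k → Finset Bool) → Prop)
    [DecidablePred (fun A : Set (Gr k) => P (patX k A) (patG k A))]
    [DecidablePred (fun x : Finset (Fin 4) × (Ear k → Finset Bool) => P x.1 x.2)] :
    ((subsetsFin (ears k)).filter (fun A => P (patX k A) (patG k A))).card
      = ((Finset.univ : Finset (Finset (Fin 4) × (Ear k → Finset Bool))).filter (fun x => P x.1 x.2)).card := by
  refine Finset.card_nbij' (fun A => (patX k A, patG k A)) (fun x => earsOf k x.1 x.2) ?_ ?_ ?_ ?_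
  · intro A hA
    rw [Finset.mem_coe, Finset.mem_filter] at hA
    rw [Finset.mem_coe, Finset.mem_filter]
    exact ⟨Finset.mem_univ _, hA.2⟩
  · intro x hx
    rw [Finset.mem_coe, Finset.mem_filter] at hx
    rw [Finset.mem_coe, Finset.mem_filter, mem_subsetsFin, ears_ground, patX_earsOf, patG_earsOf]
    exact ⟨Set.subset_univ _, hx.2⟩
  · intro A _
    exact earsOf_pat A
  · intro x _
    show (patX k (earsOf k x.1 x.2), patG k (earsOf k x.1 x.2)) = x
    rw [patX_earsOf, patG_earsOf]

/-- **THE SHADOW LEVELS OF `C₄ + ears` ARE THE LEVEL SUM**: on the tight layer `(K + 3, K + 1)`,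
`#∂_u 𝓑 = levelSum k u` for every `u`. -/
theorem card_shadowLev_ears (u : ℕ) :
    (shadowLev (ears k) u (PerFlat.Uq (ears k) (∑ j, k j + 3) (∑ j, k j + 1))).card = levelSum k u := by
  classical
  have h1 : (shadowLev (ears k) u (PerFlat.Uq (ears k) (∑ j, k j + 3) (∑ j, k j + 1))).card
      = ((subsetsFin (ears k)).filter (fun A => (∀ j, hostMiss k (patG k A) j ≤ 1) ∧
          levelCond (∑ j, k j) u (patX k A) (hostType k (patG k A)) = true)).card := by
    unfold shadowLev
    congr 1
    apply Finset.filter_congr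
    intro A _
    rw [rk_ears_pat, exists_mem_Uq_subset_iff_ears]
    exact rank_upPat_iff_levelCond (patX k A) (patG k A) u
  rw [h1, card_filter_ears (fun X g => (∀ j, hostMiss k g j ≤ 1) ∧
    levelCond (∑ j, k j) u X (hostType k g) = true), card_filter_pattern_eq_levelSum]

end PercRepro.RankDist
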